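import Summits.Ventures.LatticeQCDFlow.Scaling.StarHubChainFirstOrder

/-!
HONEST FRAMING: exact (Metropolis-corrected) sampling algorithms for lattice gauge theory; figures
of merit are autocorrelation/cost numbers at stated couplings and volumes; no continuum-physics
claim.

# OneAttemptCertificate — WITH THE CONSTANT `c ≥ 2K+2` IN THE PRODUCT POTENTIAL, ONE COUPLED ATTEMPT FROM ANY EQUAL-HUB PAIR STATE SATISFIES THE FINITE-ODDS CRITERION WITH ROOM
# `2(1−θ̄) ≥ p`: `G₁·(c + M_X + M_Y − 2)/Δ + R₁X + R₁Y − 2θ̄ ≥ 2(1 − θ̄)` FOR EVERY FINITE CONTENT TYPE, EVERY PAIR OF LAWS WITH `p·μ_1 ≤ μ_0`, EVERY PAIR OF COMPOSITIONS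
# — THE BASE CASE OF THE ALL-ODDS CONJECTURE OF MEMO-gen36 (lean-2 GEN-36, ours)

Venture-side (OURS).  Cell `lqcd-flow` (pub-lqcd), unit `pub-lqcd-lean-2-g36`, 2026-08-29.  Chapter W (item 1 (i) at finite swap odds), file 10.  The criterion of
`Scaling/FiniteOddsMixtureReduction` ∕ `Scaling/FiniteOddsPersistenceForm` for the potential `Ψ = Δ·Φ`, `Φ = c + Σ_vθ_v(N_X+N_Y)(v) − 2(1−σ)θ_z`, asks per equal-hub pair state for a
lower bound on `G̃·(Φ+e−2)/Δ + R̃_X + R̃_Y − 2θ̄` with the TAIL laws; here it is proved for the ONE-ATTEMPT laws `K_X(z,·)`, `K_Y(z,·)` (the tail laws at `σ → 0`, and the first term of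
their geometric mixture at any `σ`), with everything explicit: by `Scaling/StarHubChainFirstOrder`, `G₁ ≥ pW_zΔ/K` and `R₁ = (K_Nθ)(z) ≥ θ_z − (pW_z/K)·Σ_{v≠z}N_vθ_v` per copy; the
masses satisfy `M ≥ Σ_{v≠z}N_vθ_v + θ_z` (the hub particle); hence `G₁(c + M_X + M_Y − 2)/Δ + R₁X + R₁Y − 2θ̄ ≥ (pW_z/K)(c − 2 + 2θ_z) + 2θ_z − 2θ̄`, and for `c ≥ 2K + 2` the first
term is `≥ 2pW_z ≥ 2(1−θ_z)`, leaving **`≥ 2(1−θ̄) ≥ p`** (`Scaling/UrnProductCertificate`, `theta_fresh_le`) — the same room as the urn certificate of chapter V file 6, in every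
state, with NO condition on the swap odds.  Why the constant: the distance gain of one attempt is `≍ pW_zΔ/K`; a constant `c ≍ K` in `Φ` turns it into the absolute gain `≍ pW_zΔ`
that pays for the hub particle being lighter than a fresh one (`2(θ̄ − θ_z) ≤ 2pW_z`) — the deficit that breaks `c = 2` at finite odds (memo-36 §3).  Hypothesis-equations, one
pair state, no chain.

## What is proved

* `oneAttempt_mass_ge` (`Σ_vθ_vN(v) ≥ Σ_{v≠z}N(v)θ_v + θ_z` for `N(z) ≥ 1`), **`oneAttempt_criterion_ge`** (the displayed inequality for any `c ≥ 2K+2`),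
  **`oneAttempt_criterion_ge_p`** (`… ≥ p` under `Σμ_0 = 1`, `Σμ_0W = 1`).

Reading (toy of this generation, NOTHING CLAIMED): with `c = K` resp. `2K` the full criterion (all attempts, optimal coupling) has `κ_min ∈ [0.14,0.66]` resp. `[0.12,0.71]` over 25 laws,
`τ ∈ [0.05, 2]`, K-stable to 256, but a random search over laws finds states needing `c ≥ 2K` at `τ = 0.1`; `c = 2K+2` is the constant this first-order computation singles out.  NOT
CLAIMED: the criterion for the tail laws at `σ > 0` (the later attempts).  Literature grade (cell rule): OWN, elementary; nothing cited as a fact; no new bib keys.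
-/

open Finset

namespace Summit.Ventures.LatticeQCDFlow.Scaling

section OneAttempt
variable {S : Type*} [Fintype S] [DecidableEq S]
variable {W θ μ0 : S → ℝ} {acc : S → S → ℝ} {p c : ℝ} {K : ℕ} {NX NY : S → ℕ} {KX KY : S → S → ℝ}

/-- The full `θ`-mass contains the non-`z` levels and the hub particle: `Σ_vθ_vN(v) ≥ Σ_{v≠z}N(v)θ_v + θ_z` when `N(z) ≥ 1`, `θ ≥ 0`. [ours] -/
theorem oneAttempt_mass_ge (hθ0 : ∀ v, 0 ≤ θ v) {N : S → ℕ} {z : S} (hz : N z ≠ 0) :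
    ∑ v ∈ univ.erase z, (N v : ℝ) * θ v + θ z ≤ ∑ v, θ v * (N v : ℝ) := by
  rw [← Finset.sum_erase_add univ (fun v => θ v * (N v : ℝ)) (mem_univ z)]
  have h1 : (1 : ℝ) ≤ N z := by exact_mod_cast Nat.one_le_iff_ne_zero.mpr hz
  have h2 : θ z ≤ θ z * (N z : ℝ) := le_mul_of_one_le_right (hθ0 z) h1
  have h3 : ∑ v ∈ univ.erase z, (N v : ℝ) * θ v = ∑ v ∈ univ.erase z, θ v * (N v : ℝ) := sum_congr rfl fun v _ => mul_comm _ _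
  linarith

/-- **THE ONE-ATTEMPT CRITERION.**  Common legal hub `z`, compositions `N_X`, `N_Y` of `K+1` particles with surplus mass `Δ ≥ 1` (both one-sided surplus sums equal `Δ`), one-step laws
`K_X(z,·)`, `K_Y(z,·)`, weights `θ = 1/(1+pW)`, any constant `c ≥ 2K+2`:
`G₁·(c + M_X + M_Y − 2)/Δ + R₁X + R₁Y − 2θ̄ ≥ 2(1 − θ̄)` where `G₁ = K_X(z,·)(A) − K_Y(z,·)(A) − Σ_C (K_Y(z,·) − K_X(z,·))⁺`, `R₁ = Σ_w K(z,w)θ_w`, `M = Σθ N`, `θ̄ = Σμ_0θ`. [ours] -/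
theorem oneAttempt_criterion_ge (hW : ∀ v, 0 < W v) (hp0 : 0 ≤ p) (hp : ∀ v, p * W v ≤ 1) (hθ : ∀ v, θ v = 1 / (1 + p * W v))
    (hacc : ∀ h v, acc h v = min 1 (W h / W v))
    (hKX : ∀ h v, h ≠ v → KX h v = if NX h = 0 then 0 else (NX v : ℝ) / K * acc h v) (hKXd : ∀ h, KX h h = 1 - ∑ v ∈ univ.erase h, KX h v)
    (hKY : ∀ h v, h ≠ v → KY h v = if NY h = 0 then 0 else (NY v : ℝ) / K * acc h v) (hKYd : ∀ h, KY h h = 1 - ∑ v ∈ univ.erase h, KY h v)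
    (hK : 1 ≤ K) {z : S} (hzX : NX z ≠ 0) (hzY : NY z ≠ 0)
    {D : ℝ} (hD1 : 1 ≤ D) (hDA : ∑ w, ((NX w : ℝ) - NY w) * (if NY w < NX w then (1 : ℝ) else 0) = D)
    (hDB : ∑ w, ((NY w : ℝ) - NX w) * (if NX w < NY w then (1 : ℝ) else 0) = D) (hc : 2 * (K : ℝ) + 2 ≤ c) :
    2 * (1 - ∑ v, μ0 v * θ v)
      ≤ (∑ w, KX z w * (if NY w < NX w then (1 : ℝ) else 0) - ∑ w, KY z w * (if NY w < NX w then (1 : ℝ) else 0)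
            - ∑ w, max (KY z w - KX z w) 0 * (if NX w = NY w then (1 : ℝ) else 0))
          * (c + ∑ v, θ v * (NX v : ℝ) + ∑ v, θ v * (NY v : ℝ) - 2) / D
        + ∑ w, KX z w * θ w + ∑ w, KY z w * θ w - 2 * ∑ v, μ0 v * θ v := by
  have hθm := theta_mem hW hp0 hp hθ
  have hθ0 : ∀ v, 0 ≤ θ v := fun v => by linarith [(hθm v).1]
  have hK0 : (0 : ℝ) < K := by exact_mod_cast hK
  have hD0 : 0 < D := by linarith
  -- the gain
  have hG := starHub_oneStep_gain_ge hW hp hacc hKX hKXd hKY hKYd hK hzX hzY hDA hDB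
  set G : ℝ := ∑ w, KX z w * (if NY w < NX w then (1 : ℝ) else 0) - ∑ w, KY z w * (if NY w < NX w then (1 : ℝ) else 0)
            - ∑ w, max (KY z w - KX z w) 0 * (if NX w = NY w then (1 : ℝ) else 0) with hGdef
  -- the deleted masses
  have hRX := starHub_theta_drift_ge hW hp0 hθ hacc hKX hKXd hzX
  have hRY := starHub_theta_drift_ge hW hp0 hθ hacc hKY hKYd hzY
  have hAX : 0 ≤ (∑ v ∈ univ.erase z, KX z v) * (1 - θ z) :=
    mul_nonneg (sum_nonneg fun v hv => starHub_offDiag_nonneg hW hacc hKX (ne_of_mem_erase hv).symm) (by linarith [(hθm z).2])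
  have hAY : 0 ≤ (∑ v ∈ univ.erase z, KY z v) * (1 - θ z) :=
    mul_nonneg (sum_nonneg fun v hv => starHub_offDiag_nonneg hW hacc hKY (ne_of_mem_erase hv).symm) (by linarith [(hθm z).2])
  -- the masses contain the levels and the hub
  have hMX := oneAttempt_mass_ge hθ0 (N := NX) hzX
  have hMY := oneAttempt_mass_ge hθ0 (N := NY) hzY
  set mX := ∑ v ∈ univ.erase z, (NX v : ℝ) * θ v with hmX
  set mY := ∑ v ∈ univ.erase z, (NY v : ℝ) * θ v with hmY
  have hmX0 : 0 ≤ mX := sum_nonneg fun v _ => mul_nonneg (Nat.cast_nonneg _) (hθ0 v)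
  have hmY0 : 0 ≤ mY := sum_nonneg fun v _ => mul_nonneg (Nat.cast_nonneg _) (hθ0 v)
  -- `L = c + M_X + M_Y − 2 ≥ c − 2 + 2θ_z + mX + mY ≥ 0`
  set L : ℝ := c + ∑ v, θ v * (NX v : ℝ) + ∑ v, θ v * (NY v : ℝ) - 2 with hL
  have hLge : c - 2 + 2 * θ z + mX + mY ≤ L := by rw [hL]; linarith
  have hL0 : 0 ≤ L := by nlinarith [(hθm z).1, hK0]
  -- `G·L/D ≥ (pW_z/K)·L`
  have hpW0 : 0 ≤ p * W z := mul_nonneg hp0 (hW z).le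
  have hGL : p * W z / K * L ≤ G * L / D := by
    have h1 : p * W z / K ≤ G / D := by
      rw [div_le_div_iff₀ hK0 hD0]
      calc p * W z * D = p * W z * D / K * K := by field_simp
        _ ≤ G * K := mul_le_mul_of_nonneg_right hG hK0.le
    calc p * W z / K * L ≤ G / D * L := mul_le_mul_of_nonneg_right h1 hL0
      _ = G * L / D := by ring
  -- `1 − θ_z = pW_zθ_z ≤ pW_z`
  have hone : 1 - θ z ≤ p * W z := by
    have e : 1 - θ z = p * W z * θ z := by
      have hden : 0 < 1 + p * W z := by linarith
      rw [hθ z]; field_simp; ring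
    rw [e]; exact mul_le_of_le_one_right hpW0 (hθm z).2
  -- assemble: `(pW_z/K)(c − 2 + 2θ_z + mX + mY) + 2θ_z − (pW_z/K)(mX + mY) − 2θ̄ ≥ 2(1−θ̄)`
  have hkey : 2 * (1 - θ z) ≤ p * W z / K * (c - 2 + 2 * θ z) := by
    have h2 : 2 * (K : ℝ) ≤ c - 2 + 2 * θ z := by linarith [(hθm z).1]
    calc 2 * (1 - θ z) ≤ 2 * (p * W z) := by linarith
      _ = p * W z / K * (2 * K) := by field_simp
      _ ≤ p * W z / K * (c - 2 + 2 * θ z) := mul_le_mul_of_nonneg_left h2 (div_nonneg hpW0 hK0.le)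
  have hexp : p * W z / K * (c - 2 + 2 * θ z + mX + mY) ≤ p * W z / K * L := mul_le_mul_of_nonneg_left hLge (div_nonneg hpW0 hK0.le)
  have eX : ∑ w, KX z w * θ w ≥ θ z - p * W z / K * mX := by linarith
  have eY : ∑ w, KY z w * θ w ≥ θ z - p * W z / K * mY := by linarith
  have hdist : p * W z / K * (c - 2 + 2 * θ z + mX + mY) = p * W z / K * (c - 2 + 2 * θ z) + p * W z / K * mX + p * W z / K * mY := by ring
  linarith

/-- **… and therefore `≥ p`** (`μ_0 ≥ 0`, `Σμ_0 = 1`, `Σμ_0W = 1`: chapter V file 6's `θ̄ ≤ 1 − p/2`). [ours] -/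
theorem oneAttempt_criterion_ge_p (hW : ∀ v, 0 < W v) (hp0 : 0 ≤ p) (hp : ∀ v, p * W v ≤ 1) (hθ : ∀ v, θ v = 1 / (1 + p * W v))
    (hμ0 : ∀ v, 0 ≤ μ0 v) (hμ1 : ∑ v, μ0 v = 1) (hμW : ∑ v, μ0 v * W v = 1)
    (hacc : ∀ h v, acc h v = min 1 (W h / W v))
    (hKX : ∀ h v, h ≠ v → KX h v = if NX h = 0 then 0 else (NX v : ℝ) / K * acc h v) (hKXd : ∀ h, KX h h = 1 - ∑ v ∈ univ.erase h, KX h v)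
    (hKY : ∀ h v, h ≠ v → KY h v = if NY h = 0 then 0 else (NY v : ℝ) / K * acc h v) (hKYd : ∀ h, KY h h = 1 - ∑ v ∈ univ.erase h, KY h v)
    (hK : 1 ≤ K) {z : S} (hzX : NX z ≠ 0) (hzY : NY z ≠ 0)
    {D : ℝ} (hD1 : 1 ≤ D) (hDA : ∑ w, ((NX w : ℝ) - NY w) * (if NY w < NX w then (1 : ℝ) else 0) = D)
    (hDB : ∑ w, ((NY w : ℝ) - NX w) * (if NX w < NY w then (1 : ℝ) else 0) = D) (hc : 2 * (K : ℝ) + 2 ≤ c) :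
    p ≤ (∑ w, KX z w * (if NY w < NX w then (1 : ℝ) else 0) - ∑ w, KY z w * (if NY w < NX w then (1 : ℝ) else 0)
            - ∑ w, max (KY z w - KX z w) 0 * (if NX w = NY w then (1 : ℝ) else 0))
          * (c + ∑ v, θ v * (NX v : ℝ) + ∑ v, θ v * (NY v : ℝ) - 2) / D
        + ∑ w, KX z w * θ w + ∑ w, KY z w * θ w - 2 * ∑ v, μ0 v * θ v := by
  have h := oneAttempt_criterion_ge (μ0 := μ0) hW hp0 hp hθ hacc hKX hKXd hKY hKYd hK hzX hzY hD1 hDA hDB hc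
  have hf := theta_fresh_le hW hp0 hp hθ hμ0 hμ1 hμW
  linarith

end OneAttempt

end Summit.Ventures.LatticeQCDFlow.Scaling
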